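import Literature.Probability.RandomPlanarGeometry.YangBaxterSAWHexDictionaryWoundSum
import Literature.Probability.RandomPlanarGeometry.YangBaxterSAWExcursionReversal
import HarnessLib

/-!
# The hexagonal dictionary, signed: Duminil-Copin–Smirnov's loop winding number IS the winding number of
# Glazman–Manolescu's excursion polygon about the root

Source: H. Duminil-Copin, S. Smirnov, *The connective constant of the honeycomb lattice equals `√(2+√2)`*,
Ann. of Math. 175 (2012), Lemma 1 and its proof [DuminilCopinSmirnov2012]; A. Glazman, I. Manolescu,
*Self-avoiding walk on `ℤ²` with Yang–Baxter weights: universality of critical fugacity and 2-point function*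
(2019), §1 (θ = π/3, Fig. 2) and Lemma 2.1 [GlazmanManolescu2019]; A. Glazman, *Connective constant for a weighted
self-avoiding walk on `ℤ²`* (2015), Lemma 3.1 [Glazman2015WeightedSAW]; R. Courant, H. Robbins, *What is
Mathematics?*, Ch. V Appendix §2 (the even–odd rule) [CourantRobbins1958].

The winding file `YangBaxterSAWHexDictionaryWinding` proved the dictionary of the two exceptional classes MOD 2: for a
class-`B2a` walk `ω` at a rhombus `f` from the origin whose arc in `f` is not a `θ`-corner, the winding number
`loopWnd` of the loop of its honeycomb walk about the root face is congruent mod `2` to the number of crossings of the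
ray behind the root by its excursion polygon `J`, whence «encircling ⟺ wound» (`loopWnd ≠ 0 ⟺ AJ ≠ 0`) by the
Jordan bound on both sides. This file removes the «mod 2»: THE TWO WINDING NUMBERS ARE EQUAL AS INTEGERS,

`AJ(root) = 2π · loopWnd`   (`ΩG.AJ_root_eq_two_pi_mul_loopWnd`), i.e. `loopWnd = wind(J; root)` (`ΩG.loopWnd_hvWalk_eq_wind`),

by comparing SIGNS on the two sides (both are `0` or `±1`):
* on the honeycomb side (§1) a simple cycle winds `+1` about the faces inside it iff it is positively oriented
  (`HV.IsCyc.six_mul_wnd_eq_cturn`, from the tree's `Good`/`good_or_good_reverse`), and the lane's loop lemma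
  (`HexSAWVertexRelationHoleRoot.cturn_eq_six_mul_turn_of_wnd_ne_zero`: a cycle seen from an inside entrance edge turns by
  `+6τ`) gives ★ `HV.wnd_loop_eq_turn_of_ne_zero`: AN ENCIRCLING LOOP WINDS BY ITS ENTRANCE TURN `τ = ±1` (the turn from the
  dart by which the walk first reaches the loop vertex to the first dart of the loop);
* on the Yang–Baxter side (§3) the sign rule of `YangBaxterSAWExcursionJordan` (Part T, `ΩG.AJ_midPt_side_eq`) transported along
  the prefix (`ΩG.AJ_qQ_zero_eq_AJ_root`) gives `AJ(root) ∈ {0, 2π·chordSign(z₀; z₁, z₂)}` at ANY rooted rhombus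
  (`ΩG.AJ_root_eq_zero_or_eq_chordSign`);
* the entrance turn of the honeycomb loop of `ω` is read off the class `(z₀, z₁, z₂)` (§4, `ΩG.exists_hvWalk_eq_lw_entrance`:
  `+1/−1` by the tables `turn_hvAcross_hv_hv` of the wound-sum file and `turn_hv_hv_hvAcross` here), and ★ THE TWO TABLES
  COINCIDE: `chordSign(z₀; z₁, z₂)` = entrance turn for all 16 non-corner classes (`chordSign_eq_entranceTurn`, §2).
So for a WOUND walk `loopWnd = chordSign(z₀; z₁, z₂) = AJ/2π` (`ΩG.loopWnd_hvWalk_eq_chordSign_of_wound`), for an unwound one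
both vanish: Duminil-Copin–Smirnov's orientation of the encircling loop and Glazman–Manolescu's orientation of the wound
excursion are one and the same integer.

§6 does the same for the `θ`-CORNER returning walks, whose encircling term is the honeycomb walk PUSHED across the
short diagonal (the winding file's edition 6): the entrance turn of its loop is the turn of the corner arc (`+1` for
`z₀ ∈ {W, E}`, `−1` for `z₀ ∈ {S, N}`, `turn_hvAcross_hv_hvAcross`), again equal to the chord sign (`chordSign_eq_cornerTurn`), and
`AJ(root) = 2π · loopWnd (f.hv z₀) (hvWalk ++ [f.hv z₀])` (`ΩG.AJ_root_eq_two_pi_mul_loopWnd_of_corner`). So EVERY wound returning walk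
of non-zero weight, corner arc or not, has its loop winding number equal to its excursion winding number.

No new definitions; the «entrance turn» is the inline `if (ω.1).tri = z₁.tri then (±1 by z₁) else (∓1 by z₀)`.
Sections §1–§5: non-`θ`-corner arcs; §6: `θ`-corner arcs.

Edition 2 (§7–§8) imports the reversal lemma (`YangBaxterSAWExcursionReversal`: `AJ(rev ω) = −AJ(ω)`) and closes the orientation
case of the hole-root bookkeeping: ★★★ `ΩG.WE_sub_excursionWinding_eq_two_mul_AJ_root` — for EVERY class-`B2a` walk at a rooted rhombus of
any domain and every `θ`, `WE − excursionWinding(θ; z₀, z₁, z₂) = 2·AJ(root)` (the far-cell file had `2A`, `A ∈ {AJ(ω), −AJ(rev ω)}`);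
hence wound ⟺ `AJ(root) ≠ 0` (any `θ`), a wound walk winds `2π·chordSign` and its companion `−2π·chordSign` (§7); and at `π/3` the
winding hypotheses of §5–§6 are discharged: every WOUND returning walk's loop winds by its chord sign, and Duminil-Copin–Smirnov's loop
does not wind iff Glazman–Manolescu's walk is unwound (§8). Editions: ed.1 = §1–§6; ed.2 = ed.1 verbatim ⊕ one import ⊕ §7–§8.

Edition 3 (§9) restates the wound-sum file's COUNTING FORM in Glazman–Manolescu's own vocabulary: `C(f)` = the number of returning
walks at `f` of non-zero `π/3`-weight with `WE ≠ excursionWinding` (★★ `ΩG.card_encircling_add_card_encircling_eq_card_WE_ne`), no encircling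
loop ⟺ every such walk has weight zero, and per walk the honeycomb loop winds iff the walk is wound. ed.3 = ed.2 verbatim ⊕ §9.
Edition 4 (§10): if every WE-wound returning walk at `f` has `π/3`-weight zero (in particular if no encircling loop passes the two
triangles of `f`), the Yang–Baxter relation holds at `f` at `π/3` (★★ `ΩG.vertexFunctional_pi_div_three_origin_eq_zero_of_forall_WE_ne`).
ed.4 = ed.3 verbatim ⊕ §10.
-/

noncomputable section

open Real

namespace Literature.Probability.RandomPlanarGeometry.SAW

/-! ## §1. Honeycomb side: an encircling loop winds by its entrance turn -/

namespace HV

variable {V : Finset HV} {v : HV}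

/-- **The winding number of a simple cycle about a face inside it is its orientation**: `6 · wnd l F = cturn l`
whenever `wnd l F ≠ 0` — a positively oriented simple cycle of the honeycomb lattice (`Good`, turning number `+6`)
winds `+1` about the faces it encloses, a negatively oriented one `−1` (the tree's `good_or_good_reverse`,
`Good.wnd_eq_zero_or_one`, `wnd_reverse`). [cite: DuminilCopinSmirnov2012, proof of Lemma 1 (the winding of the loop about a)]
[cite: CourantRobbins1958, Ch. V Appendix §2 (orientation and the inside of a polygon)] -/
theorem IsCyc.six_mul_wnd_eq_cturn {l : List HV} (hc : IsCyc l) {F : ℤ × ℤ} (hF : wnd l F ≠ 0) :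
    6 * wnd l F = cturn l := by
  rcases good_or_good_reverse hc with hg | hg
  · rcases hg.wnd_eq_zero_or_one hc F with h0 | h1
    · exact absurd h0 hF
    · rw [h1, hg.1]; norm_num
  · have hc' : IsCyc l.reverse := hc.reverse
    rcases hg.wnd_eq_zero_or_one hc' F with h0 | h1
    · rw [wnd_reverse] at h0; exact absurd (neg_eq_zero.1 h0) hF
    · rw [wnd_reverse] at h1
      rw [(good_reverse_iff hc.1).1 hg |>.1]
      omega

/-- ★ **THE HONEYCOMB SIGN LAW: AN ENCIRCLING LOOP WINDS BY ITS ENTRANCE TURN.** For a loop walk `w, l₁, v, l₂, v` of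
Duminil-Copin–Smirnov on a vertex set `V ∌ w`: if its loop `v :: l₂` winds about the root face, its winding number IS the
entrance turn `τ = turn (lwS l₁) v (l₂.head) = ±1` — the turn from the dart by which the walk first reaches `v` to the first
dart of the loop (left `+1`: the loop is run counterclockwise and winds `+1`; right `−1`: clockwise, `−1`). The lane's
loop lemma (`cturn_eq_six_mul_turn_of_wnd_ne_zero`: seen from an inside entrance edge the cycle turns by `+6τ`) with
`IsCyc.six_mul_wnd_eq_cturn`. [cite: DuminilCopinSmirnov2012, proof of Lemma 1 («we used the fact that a is on the boundary and Ω is simply connected»)]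
[cite: CourantRobbins1958, Ch. V Appendix §2 (orientation and the inside of a polygon)] -/
theorem wnd_loop_eq_turn_of_ne_zero (hw : wOut ∉ V) {l₁ l₂ : List HV} (hP : IsMidWalk V (lw l₁ v l₂))
    (hl₂ : l₂ ≠ []) (h1 : wnd (v :: l₂) (1, 0) ≠ 0) :
    wnd (v :: l₂) (1, 0) = turn (lwS l₁) v (l₂.head hl₂) := by
  obtain ⟨hvs, -, -, -, -, -, hsn⟩ := lw_nbrs_of_not_mem hw hP hl₂
  have hcyc := lw_isCyc hw hP hl₂
  have hwnd := wnd_leftFace_entrance_eq hw hP hl₂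
  have hct := cturn_eq_six_mul_turn_of_wnd_ne_zero hcyc hl₂ hvs hsn (by rw [hwnd]; exact h1)
  have h6 := IsCyc.six_mul_wnd_eq_cturn hcyc h1
  rw [hct] at h6
  omega

/-- The loop winding number of a loop walk is `0` or its entrance turn. [cite: DuminilCopinSmirnov2012, proof of Lemma 1] -/
theorem wnd_loop_eq_zero_or_eq_turn (hw : wOut ∉ V) {l₁ l₂ : List HV} (hP : IsMidWalk V (lw l₁ v l₂)) (hl₂ : l₂ ≠ []) :
    wnd (v :: l₂) (1, 0) = 0 ∨ wnd (v :: l₂) (1, 0) = turn (lwS l₁) v (l₂.head hl₂) := by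
  by_cases h1 : wnd (v :: l₂) (1, 0) = 0
  · exact Or.inl h1
  · exact Or.inr (wnd_loop_eq_turn_of_ne_zero hw hP hl₂ h1)

end HV

namespace YangBaxter

open MidEdge
open Literature.Barriers.CriticalPhenomena.PlaquetteWalk
open Literature.Barriers.CriticalPhenomena (PlaquetteWalk.dom)
open Literature.Topology.PlaneTopology

/-! ## §2. The lattice tables: the turn into a side from the other triangle; chord sign = entrance turn -/

/-- **The turn into a side from the other triangle.** Arriving in `f.hv s` along the short diagonal (from the other triangle
`f.hv σ`, `σ.tri ≠ s.tri`) and leaving across the side `s` is a turn by `+π/3` (`+1`) for `s ∈ {W, E}` and by `−π/3` (`−1`) for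
`s ∈ {S, N}` (the reverse darts of the wound-sum file's `turn_hvAcross_hv_hv`, `HV.turn_rev`).
[cite: DuminilCopinSmirnov2012, §2 (the winding of a walk on the hexagonal lattice, by ±π/3 per vertex)] -/
theorem turn_hv_hv_hvAcross (f : Face) {s σ : Side} (h : σ.tri ≠ s.tri) :
    HV.turn (f.hv σ) (f.hv s) (f.hvAcross s) = if s = .W ∨ s = .E then 1 else -1 := by
  rw [HV.turn_rev, turn_hvAcross_hv_hv f h]
  split_ifs <;> simp

/-- ★ **GLAZMAN–MANOLESCU'S CHORD SIGN IS DUMINIL-COPIN–SMIRNOV'S ENTRANCE TURN.** For the 16 ordered classes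
`(z₀, z₁, z₂)` of three distinct sides with a non-`θ`-corner arc `z₀ → z₁`, the chord sign `ε(z₀; z₁, z₂)` of
`YangBaxterSAWExcursionJordan` (the sign of the winding of a wound excursion polygon `z₁ → … → z₂` at the midpoint of the side
`z₀`) equals the entrance turn of the honeycomb loop of such a walk at its return triangle `f.hv z₂` (§4): `±1` according
to `z₁ ∈ {W, E}` when the return triangle is the exit triangle (`z₂.tri = z₁.tri`; entrance dart along the diagonal, first loop
dart across `z₁`), `∓1` according to `z₀ ∈ {W, E}` when it is the entry triangle (entrance across `z₀`, first loop dart along the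
diagonal). A finite check (`decide`). [cite: GlazmanManolescu2019, Lemma 2.1 (statement, "in the form given in [Gl]")]
[cite: Glazman2015WeightedSAW, Lemma 3.1 (proof, pp. 6–7: the classes of walks through a rhombus)] [cite: DuminilCopinSmirnov2012, proof of Lemma 1 (the winding of the loop)] -/
theorem chordSign_eq_entranceTurn {z₀ z₁ z₂ : Side} (h01 : z₀ ≠ z₁) (h02 : z₀ ≠ z₂) (h12 : z₁ ≠ z₂)
    (hk : arcKind z₀ z₁ ≠ .corner) :
    chordSign z₀ z₁ z₂ =
      if z₂.tri = z₁.tri then (if z₁ = .W ∨ z₁ = .E then 1 else -1) else (if z₀ = .W ∨ z₀ = .E then -1 else 1) := by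
  revert h01 h02 h12 hk
  cases z₀ <;> cases z₁ <;> cases z₂ <;> decide

namespace ΩG

open YBWalk HV

open private fc_fh fc_ne fh_add_Mv
  from Literature.Probability.RandomPlanarGeometry.YangBaxterSAWGeneralDomain
open private midPt_not_mem_edges_at from Literature.Probability.RandomPlanarGeometry.YangBaxterSAWExcursionJordan

/-! ## §3. Yang–Baxter side: the sign rule at the root of ANY rooted rhombus -/

section General

variable {D : Set Face} {a : MidEdge} {r : Face} {ω : ΩG D a r} {hr : RootedFace D a r}

/-- ★ **THE SIGN RULE AT THE ROOT.** For every class-`B2a` walk `ω` at ANY rooted rhombus `r` of ANY face domain (first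
side `z₀`, exit `z₁`, return `z₂ = ω.1`): the swept angle of its excursion polygon at the midpoint of the root is `0` or
`2π · chordSign(z₀; z₁, z₂)` — it is one number at the root and at the midpoint of the first side (transport along the prefix,
`ΩG.AJ_qQ_zero_eq_AJ_root`), where the sign rule `ΩG.AJ_midPt_side_eq` of `YangBaxterSAWExcursionJordan` evaluates it. (The
far-cell law's `WE_sub_excursionWinding_eq_two_mul` carries the same fact inside an existential.)
[cite: GlazmanManolescu2019, Lemma 2.1 (statement, "in the form given in [Gl]")] [cite: Glazman2015WeightedSAW, Lemma 3.1 (proof, pp. 6–7)]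
[cite: CourantRobbins1958, Ch. V Appendix §2 (the even–odd rule)] -/
theorem AJ_root_eq_zero_or_eq_chordSign (h : ω.IsB2a) :
    ω.AJ hr h (toC (midPt a)) = 0 ∨
      ω.AJ hr h (toC (midPt a)) = 2 * Real.pi * chordSign ω.2.firstSideG (ω.z1 hr h) ω.1 := by
  have hd := ω.2.sides_distinctG hr h.1
  rw [ω.returnSide_of_isB2a h] at hd
  have h01 : ω.2.firstSideG ≠ ω.z1 hr h := fun e => hd.1 e.symm
  have e : ω.AJ hr h (toC (midPt a)) = ω.AJ hr h (toC (midPt (r.side ω.2.firstSideG))) := by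
    rw [← ω.AJ_qQ_zero_eq_AJ_root (hr := hr) (h := h), ΩG.qQ, ω.Qp_zero (hr := hr) h, midPt_side]
  rw [e]
  exact AJ_midPt_side_eq h h01 hd.2.1.symm

/-- The wound case: `AJ(root) ≠ 0 ⇒ AJ(root) = 2π · chordSign(z₀; z₁, z₂)`. [cite: GlazmanManolescu2019, Lemma 2.1]
[cite: Glazman2015WeightedSAW, Lemma 3.1 (proof, pp. 6–7)] -/
theorem AJ_root_eq_chordSign_of_ne_zero (h : ω.IsB2a) (hA : ω.AJ hr h (toC (midPt a)) ≠ 0) :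
    ω.AJ hr h (toC (midPt a)) = 2 * Real.pi * chordSign ω.2.firstSideG (ω.z1 hr h) ω.1 :=
  (AJ_root_eq_zero_or_eq_chordSign (hr := hr) h).resolve_left hA

end General

/-! ## §4. The honeycomb loop of a returning walk with its entrance turn -/

section Origin

variable {D : Set Face} {f : Face} {ω : ΩG D origin f} {hr : RootedFace D origin f}

/-- The vertex from which the honeycomb walk enters its first triangle of `f`: the triangle across the first side `z₀`
(for `firstHitG = 0`: Duminil-Copin–Smirnov's `w`, across the root). [cite: GlazmanManolescu2019, §1 (Fig. 2)] -/
theorem getLast_wOut_cons_hvUpTo_firstHitG (hD : ((-1 : ℤ), (0 : ℤ)) ∉ D) (hr : RootedFace D origin f) (h : ω.IsB2a) :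
    (HV.wOut :: ω.2.hvUpTo ω.2.firstHitG).getLast (List.cons_ne_nil _ _) = f.hvAcross ω.2.firstSideG := by
  have hfh : ω.2.firstHitG < ω.2.arcs.length := ω.fh_lt h
  obtain ⟨hfc, hsIn, -⟩ := fc_fh ω hr h
  have key : (HV.wOut :: ω.2.hvUpTo ω.2.firstHitG).getLast (List.cons_ne_nil _ _) = ω.2.acrossIn ω.2.firstHitG := by
    apply Option.some_injective
    rw [← List.getLast?_eq_some_getLast]
    rcases Nat.eq_zero_or_pos ω.2.firstHitG with h0 | hpos
    · rw [h0, ω.2.acrossIn_zero_of_origin hD]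
      simp [YBWalk.hvUpTo]
    · obtain ⟨m, hm⟩ : ∃ m, ω.2.firstHitG = m + 1 := ⟨ω.2.firstHitG - 1, by omega⟩
      rw [hm, List.getLast?_cons_of_ne_nil (YBWalk.hvUpTo_ne_nil (by omega)), YBWalk.getLast?_hvUpTo_succ,
        YBWalk.acrossIn_succ_eq_hv (by omega)]
  rw [key, YBWalk.acrossIn, hfc, hsIn]

/-- Splitting the triangle list at an earlier arc: the tail starts with the next arc's first triangle.
[cite: GlazmanManolescu2019, §1 (Fig. 2)] -/
theorem exists_hvUpTo_add (γ : YBWalk D origin (f.side ω.1)) (i k : ℕ) :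
    ∃ Y : List HV, γ.hvUpTo (i + k) = γ.hvUpTo i ++ Y ∧ (0 < k → Y.head? = some ((γ.fc i).hv (γ.sIn i))) := by
  induction k with
  | zero => exact ⟨[], by simp, fun h => absurd h (lt_irrefl 0)⟩
  | succ k ih =>
    obtain ⟨Y, hY, hhead⟩ := ih
    refine ⟨Y ++ γ.arcHV (i + k), ?_, fun _ => ?_⟩
    · rw [← Nat.add_assoc, YBWalk.hvUpTo_succ, hY, List.append_assoc]
    · rcases Nat.eq_zero_or_pos k with rfl | hk
      · have hY0 : Y = [] := by
          have e : γ.hvUpTo i ++ Y = γ.hvUpTo i ++ [] := by rw [List.append_nil, ← hY, Nat.add_zero]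
          exact List.append_cancel_left e
        rw [hY0, List.nil_append, Nat.add_zero, YBWalk.head?_arcHV]
      · rw [List.head?_append, hhead hk]
        rfl

/-- ★★ **THE HONEYCOMB LOOP OF A RETURNING WALK, WITH ITS ENTRANCE TURN.** Root at the origin (`(−1, 0) ∉ D`), `ω` of class
`B2a` at `f` with a non-`θ`-corner arc `z₀ → z₁` in `f`: its honeycomb walk is a loop walk `w, l₁, v, l₂, v` at the return triangle
`v = f.hv ω.1` (the winding file's `exists_hvWalk_eq_lw_of_isB2a`), AND the entrance turn of the loop is read off the class: if
`v` is the exit triangle (`ω.1.tri = z₁.tri`) the walk first reaches `v` along the short diagonal from `f.hv z₀` and the loop starts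
across the side `z₁` — turn `+1` for `z₁ ∈ {W, E}`, `−1` for `z₁ ∈ {S, N}` (`turn_hv_hv_hvAcross`); if `v` is the entry triangle
(`ω.1.tri = z₀.tri`) the walk reaches `v` across `z₀` (from `f.hvAcross z₀`, `getLast_wOut_cons_hvUpTo_firstHitG`) and the loop
starts along the diagonal — turn `−1` for `z₀ ∈ {W, E}`, `+1` for `z₀ ∈ {S, N}` (`turn_hvAcross_hv_hv`).
[cite: GlazmanManolescu2019, §1 (Fig. 2), Lemma 2.1] [cite: Glazman2015WeightedSAW, Lemma 3.1 (proof, pp. 6–7)]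
[cite: DuminilCopinSmirnov2012, proof of Lemma 1 (the walks passing all three mid-edges of a vertex; the winding of the loop)] -/
theorem exists_hvWalk_eq_lw_entrance (hD : ((-1 : ℤ), (0 : ℤ)) ∉ D) (hr : RootedFace D origin f) (h : ω.IsB2a)
    (hκ : arcKind ω.2.firstSideG (ω.z1 hr h) ≠ .corner) :
    ∃ (l₁ l₂ : List HV) (hl₂ : l₂ ≠ []), f.hv ω.1 ∉ l₁ ∧ ω.2.hvWalk = HV.lw l₁ (f.hv ω.1) l₂ ∧
      HV.turn (HV.lwS l₁) (f.hv ω.1) (l₂.head hl₂) =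
        (if (ω.1).tri = (ω.z1 hr h).tri then (if ω.z1 hr h = .W ∨ ω.z1 hr h = .E then 1 else -1)
          else (if ω.2.firstSideG = .W ∨ ω.2.firstSideG = .E then -1 else 1)) := by
  -- bookkeeping of the class `B2a`
  have hfh : ω.2.firstHitG < ω.2.arcs.length := ω.fh_lt h
  have hM : 3 ≤ ω.Mv := three_le_Mv hr h
  have hFM : ω.2.firstHitG + ω.Mv = ω.2.arcs.length := fh_add_Mv h
  obtain ⟨hfc, hsIn, hsOut⟩ := fc_fh ω hr h
  have hz1 : ω.2.sOut ω.2.firstHitG = ω.z1 hr h := hsOut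
  have hn : 0 < ω.2.arcs.length := by omega
  have hst : ω.2.firstSideG ≠ ω.z1 hr h := by
    rw [← hsIn, ← hz1]; exact (YBWalk.side_sIn hfh).2.2
  have htri : ω.2.firstSideG.tri ≠ (ω.z1 hr h).tri := fun e => hκ ((arcKind_eq_corner_iff hst).2 e)
  -- the excursion triangles, with the head of the tail
  obtain ⟨L, hL, hhead⟩ := exists_hvUpTo_add ω.2 (ω.2.firstHitG + 1) (ω.2.arcs.length - (ω.2.firstHitG + 1))
  rw [show ω.2.firstHitG + 1 + (ω.2.arcs.length - (ω.2.firstHitG + 1)) = ω.2.arcs.length by omega] at hL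
  have hLhead : L.head? = some (f.hvAcross (ω.z1 hr h)) := by
    rw [hhead (by omega), ← YBWalk.acrossOut_eq_hv_succ (by omega), YBWalk.acrossOut, hfc, hz1]
  have hL0 : L ≠ [] := by intro e; rw [e] at hLhead; simp at hLhead
  have hLhd : L.head hL0 = f.hvAcross (ω.z1 hr h) := by
    apply Option.some_injective; rw [← List.head?_eq_some_head, hLhead]
  -- the last triangle beyond the final mid-edge is the return triangle `v = f.hv ω.1`
  have hch : ω.2.fc (ω.2.arcs.length - 1) ≠ f := fc_ne ω hr h (by omega) (by omega)
  have hv : ω.2.acrossOut (ω.2.arcs.length - 1) = f.hv ω.1 := acrossOut_last_eq_hv rfl hn hch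
  -- the arc in `f` crosses both triangles
  have harc : ω.2.arcHV ω.2.firstHitG = [f.hv ω.2.firstSideG, f.hv (ω.z1 hr h)] := by
    unfold YBWalk.arcHV
    rw [hfc, hsIn, hz1, if_neg htri]
  have hwalk : ω.2.hvWalk = HV.wOut :: (ω.2.hvUpTo ω.2.firstHitG ++ [f.hv ω.2.firstSideG, f.hv (ω.z1 hr h)] ++
      L ++ [f.hv ω.1]) := by
    rw [ω.2.hvWalk_of_origin hD hn, YBWalk.hvInner, hL, YBWalk.hvUpTo_succ, harc, hv]
  -- the triangles before the first hit are not triangles of `f`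
  have hnot : ∀ s : Side, f.hv s ∉ ω.2.hvUpTo ω.2.firstHitG := by
    intro s hs
    obtain ⟨k, hk, t, he⟩ := exists_fc_of_mem_hvUpTo hs
    have hkf : ω.2.fc k ≠ f := by
      intro e
      have hk' : k < ω.2.arcs.length := by omega
      have hface := (YBWalk.arcFace_arcAt hk').1
      rw [YBWalk.arcAt_eq hk', e, ← ω.2.nth_eq_getElem, ← ω.2.nth_eq_getElem] at hface
      exact ω.2.arcFace_ne_of_lt_firstHitG hk hk' hface
    exact hkf (Face.hv_eq_hv_iff.1 he.symm).1
  -- the vertex before the first triangle of `f`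
  have hprev := getLast_wOut_cons_hvUpTo_firstHitG (ω := ω) hD hr h
  -- which triangle of `f` is the return triangle?
  by_cases hv1 : (ω.1).tri = (ω.z1 hr h).tri
  · -- `v` is the EXIT triangle: entrance dart from `f.hv z₀`, first loop dart across the exit side
    have hvT : f.hv ω.1 = f.hv (ω.z1 hr h) := Face.hv_eq_hv_iff.2 ⟨rfl, hv1⟩
    refine ⟨ω.2.hvUpTo ω.2.firstHitG ++ [f.hv ω.2.firstSideG], L, hL0, ?_, ?_, ?_⟩
    · rw [List.mem_append, List.mem_singleton, not_or]
      refine ⟨hnot ω.1, fun e => htri ?_⟩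
      rw [hvT] at e
      exact ((Face.hv_eq_hv_iff.1 e).2).symm
    · rw [hwalk, HV.lw, hvT]
      simp
    · rw [if_pos hv1, hLhd, hvT, HV.lwS]
      simp only [List.getLast_cons (List.append_ne_nil_of_right_ne_nil _ (List.cons_ne_nil _ _)),
        List.getLast_append_of_ne_nil, List.getLast_singleton, ne_eq, List.cons_ne_nil, not_false_eq_true]
      exact turn_hv_hv_hvAcross f htri
  · -- `v` is the ENTRY triangle: entrance dart across `z₀`, first loop dart along the short diagonal
    have hv0 : (ω.1).tri = ω.2.firstSideG.tri := by
      revert hv1 htri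
      cases (ω.1).tri <;> cases ω.2.firstSideG.tri <;> cases (ω.z1 hr h).tri <;> simp
    have hvT : f.hv ω.1 = f.hv ω.2.firstSideG := Face.hv_eq_hv_iff.2 ⟨rfl, hv0⟩
    refine ⟨ω.2.hvUpTo ω.2.firstHitG, f.hv (ω.z1 hr h) :: L, List.cons_ne_nil _ _, hvT ▸ hnot _, ?_, ?_⟩
    · rw [hwalk, HV.lw, hvT]
      simp
    · rw [if_neg hv1, List.head_cons, hvT, HV.lwS, hprev]
      exact turn_hvAcross_hv_hv f (Ne.symm htri)


/-! ## §5. The signed dictionary -/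

/-- ★★★ **THE SIGNED DICTIONARY: DUMINIL-COPIN–SMIRNOV'S LOOP WINDING NUMBER IS GLAZMAN–MANOLESCU'S EXCURSION WINDING,
AS INTEGERS.** For every finite rhombus list `Dl` not containing `(−1, 0)`, rooted at the origin, every rhombus `f` and every
class-`B2a` walk `ω` at `f` of non-zero `π/3`-weight whose arc in `f` is not a `θ`-corner: the swept angle of the excursion polygon
of `ω` at the midpoint of the root equals `2π` times the winding number about the root face of the loop of its honeycomb walk,
`AJ(root) = 2π · loopWnd`. (Mod 2 this is the winding file's `loopWnd_hvWalk_eq_rayCountAt_mod_two` / «encircling ⟺ wound»;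
the sign is §1's honeycomb sign law + §3's sign rule + §2's coincidence of the two tables.) [cite: DuminilCopinSmirnov2012, proof of Lemma 1
(the winding of the loop about a)] [cite: GlazmanManolescu2019, Lemma 2.1 (statement, "in the form given in [Gl]")]
[cite: Glazman2015WeightedSAW, Lemma 3.1 (proof, pp. 6–7)] [cite: CourantRobbins1958, Ch. V Appendix §2 (the even–odd rule)] -/
theorem AJ_root_eq_two_pi_mul_loopWnd {Dl : List Face} {f : Face} {ω : ΩG (PlaquetteWalk.dom Dl) origin f}
    {hr : RootedFace (PlaquetteWalk.dom Dl) origin f} (hD : ((-1 : ℤ), (0 : ℤ)) ∉ Dl) (h : ω.IsB2a)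
    (hκ : arcKind ω.2.firstSideG (ω.z1 hr h) ≠ .corner) (hw : ω.2.weight (fun _ => π / 3) ≠ 0) :
    ω.AJ hr h (toC (midPt origin)) = 2 * π * HV.loopWnd (f.hv ω.1) ω.2.hvWalk := by
  have hD' : ((-1 : ℤ), (0 : ℤ)) ∉ PlaquetteWalk.dom Dl := hD
  have hDF : ((-1 : ℤ), (0 : ℤ)) ∉ Dl.toFinset := fun e => hD (List.mem_toFinset.1 e)
  by_cases h0 : HV.loopWnd (f.hv ω.1) ω.2.hvWalk = 0
  · rw [h0, (loopWnd_hvWalk_eq_zero_iff_AJ_root_eq_zero hD h hκ hw).1 h0]; simp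
  · have hA : ω.AJ hr h (toC (midPt origin)) ≠ 0 := (loopWnd_hvWalk_ne_zero_iff_AJ_root_ne_zero hD h hκ hw).1 h0
    obtain ⟨l₁, l₂, hl₂, hv, he, hturn⟩ := exists_hvWalk_eq_lw_entrance (ω := ω) hD' hr h hκ
    have hV : ∀ g ∈ PlaquetteWalk.dom Dl, ∀ s : Side, g.hv s ∈ triSet Dl.toFinset :=
      fun g hg s => hv_mem_triSet (List.mem_toFinset.2 hg) s
    have hP := ω.2.isMidWalk_hvWalk_of_origin hD' hV hw
    rw [he] at hP
    rw [he, HV.loopWnd_lw hv] at h0 ⊢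
    have hd := ω.2.sides_distinctG hr h.1
    rw [ω.returnSide_of_isB2a h] at hd
    rw [HV.wnd_loop_eq_turn_of_ne_zero (wOut_not_mem_triSet hDF) hP hl₂ h0, hturn]
    rcases AJ_root_eq_zero_or_eq_chordSign (hr := hr) h with hz | hcs
    · exact absurd hz hA
    have h01 : ω.2.firstSideG ≠ ω.z1 hr h := fun e => hd.1 e.symm
    have h02 : ω.2.firstSideG ≠ ω.1 := fun e => hd.2.1 e.symm
    have h12 : ω.z1 hr h ≠ ω.1 := fun e => hd.2.2 e.symm
    rw [hcs, chordSign_eq_entranceTurn h01 h02 h12 hκ]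

/-- ★★★ **`loopWnd = wind(J; root)`**: the winding number about the root face of the loop of the honeycomb walk of `ω`
(Duminil-Copin–Smirnov) equals the winding number of the excursion polygon `J` of `ω` about the midpoint of the root
(Glazman–Manolescu, via `ΩG.AJ_eq_two_pi_mul_wind`). [cite: DuminilCopinSmirnov2012, proof of Lemma 1 (the winding of the loop about a)]
[cite: GlazmanManolescu2019, Lemma 2.1] [cite: CourantRobbins1958, Ch. V Appendix §2 (the even–odd rule)]
[cite: AhlforsCA1979, Ch. 4 §2.1 (index of a point with respect to a closed curve)] -/
theorem loopWnd_hvWalk_eq_wind {Dl : List Face} {f : Face} {ω : ΩG (PlaquetteWalk.dom Dl) origin f}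
    {hr : RootedFace (PlaquetteWalk.dom Dl) origin f} (hD : ((-1 : ℤ), (0 : ℤ)) ∉ Dl) (h : ω.IsB2a)
    (hκ : arcKind ω.2.firstSideG (ω.z1 hr h) ≠ .corner) (hw : ω.2.weight (fun _ => π / 3) ≠ 0) :
    HV.loopWnd (f.hv ω.1) ω.2.hvWalk = wind (fun t ↦ polygonLoop (ω.pJlist hr h) t - toC (midPt origin)) := by
  have hb : ∀ j < ω.Mv, (ω.jFace h j).side (ω.jOut hr h j) ≠ Face.side ((0 : ℤ), (0 : ℤ)) .W :=
    fun j hj e => exit_ne_root (hr := hr) h hj e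
  have hoff := midPt_not_mem_edges_at h hb
  have e1 := AJ_eq_two_pi_mul_wind (hr := hr) h hoff
  have e2 := AJ_root_eq_two_pi_mul_loopWnd (hr := hr) hD h hκ hw
  have hπ : (2 : ℝ) * π ≠ 0 := by positivity
  have key : (2 * π) * ((HV.loopWnd (f.hv ω.1) ω.2.hvWalk : ℤ) : ℝ) =
      (2 * π) * ((wind (fun t ↦ polygonLoop (ω.pJlist hr h) t - toC (midPt origin)) : ℤ) : ℝ) := by
    rw [← e2]; exact e1
  exact_mod_cast mul_left_cancel₀ hπ key

/-- ★★ **The sign of an encircling loop is the chord sign of its class**: for a WOUND walk (non-`θ`-corner arc, non-zero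
weight) `loopWnd = chordSign(z₀; z₁, z₂)` — Duminil-Copin–Smirnov's loop is run counterclockwise about the root face exactly for
the classes of chord sign `+1`. [cite: DuminilCopinSmirnov2012, proof of Lemma 1 (the winding of the loop)]
[cite: GlazmanManolescu2019, Lemma 2.1 (statement, "in the form given in [Gl]")] [cite: Glazman2015WeightedSAW, Lemma 3.1 (proof, pp. 6–7)] -/
theorem loopWnd_hvWalk_eq_chordSign_of_wound {Dl : List Face} {f : Face} {ω : ΩG (PlaquetteWalk.dom Dl) origin f}
    {hr : RootedFace (PlaquetteWalk.dom Dl) origin f} (hD : ((-1 : ℤ), (0 : ℤ)) ∉ Dl) (h : ω.IsB2a)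
    (hκ : arcKind ω.2.firstSideG (ω.z1 hr h) ≠ .corner) (hw : ω.2.weight (fun _ => π / 3) ≠ 0)
    (hA : ω.AJ hr h (toC (midPt origin)) ≠ 0) :
    HV.loopWnd (f.hv ω.1) ω.2.hvWalk = chordSign ω.2.firstSideG (ω.z1 hr h) ω.1 := by
  have e1 := AJ_root_eq_chordSign_of_ne_zero (hr := hr) h hA
  have e2 := AJ_root_eq_two_pi_mul_loopWnd (hr := hr) hD h hκ hw
  have hπ : (2 : ℝ) * π ≠ 0 := by positivity
  have key : (2 * π) * ((HV.loopWnd (f.hv ω.1) ω.2.hvWalk : ℤ) : ℝ) =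
      (2 * π) * ((chordSign ω.2.firstSideG (ω.z1 hr h) ω.1 : ℤ) : ℝ) := by
    rw [← e2]; exact e1
  exact_mod_cast mul_left_cancel₀ hπ key

/-- **The loop winding number takes the values `0` and `chordSign(z₀; z₁, z₂)` only.**
[cite: DuminilCopinSmirnov2012, proof of Lemma 1] [cite: GlazmanManolescu2019, Lemma 2.1] -/
theorem loopWnd_hvWalk_eq_zero_or_eq_chordSign {Dl : List Face} {f : Face} {ω : ΩG (PlaquetteWalk.dom Dl) origin f}
    {hr : RootedFace (PlaquetteWalk.dom Dl) origin f} (hD : ((-1 : ℤ), (0 : ℤ)) ∉ Dl) (h : ω.IsB2a)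
    (hκ : arcKind ω.2.firstSideG (ω.z1 hr h) ≠ .corner) (hw : ω.2.weight (fun _ => π / 3) ≠ 0) :
    HV.loopWnd (f.hv ω.1) ω.2.hvWalk = 0 ∨
      HV.loopWnd (f.hv ω.1) ω.2.hvWalk = chordSign ω.2.firstSideG (ω.z1 hr h) ω.1 := by
  by_cases hA : ω.AJ hr h (toC (midPt origin)) = 0
  · exact Or.inl ((loopWnd_hvWalk_eq_zero_iff_AJ_root_eq_zero hD h hκ hw).2 hA)
  · exact Or.inr (loopWnd_hvWalk_eq_chordSign_of_wound hD h hκ hw hA)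

end Origin

end ΩG


/-! ## §6. The `θ`-corner returning walks: the signed dictionary for the pushed honeycomb walk -/

section Corner

/-- **The turn of a `θ`-corner arc.** Arriving in the triangle `f.hv s` across the side `s` and leaving across the other side `t`
of the same triangle (`s.tri = t.tri`, a `θ`-corner arc) is a turn by `+π/3` (`+1`) for `s ∈ {W, E}` (the arcs `W → N`,
`E → S`, rotation `+θ`) and by `−π/3` (`−1`) for `s ∈ {S, N}` (`N → W`, `S → E`, rotation `−θ`).
[cite: GlazmanManolescu2019, §2.1 (the rotation of an arc: `W → N` winds `θ`)] [cite: DuminilCopinSmirnov2012, §2 (winding by ±π/3 per vertex)] -/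
theorem turn_hvAcross_hv_hvAcross (f : Face) {s t : Side} (hst : s ≠ t) (h : s.tri = t.tri) :
    HV.turn (f.hvAcross s) (f.hv s) (f.hvAcross t) = if s = .W ∨ s = .E then 1 else -1 := by
  obtain ⟨k, j⟩ := f
  cases s <;> cases t <;> simp [Side.tri] at h hst <;>
    simp only [HV.turn, HV.pos, Face.hv, Face.hvAcross, Side.tri] <;> norm_num <;>
    simp only [HV.cross] <;> ring_nf <;> first | omega | rfl

/-- ★ **Chord sign = corner turn** for the 8 ordered classes with a `θ`-corner arc `z₀ → z₁`: `ε(z₀; z₁, z₂) = +1` for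
`z₀ ∈ {W, E}`, `−1` for `z₀ ∈ {S, N}` — the turn of the corner arc (`turn_hvAcross_hv_hvAcross`), which is the entrance turn of
the loop of the pushed honeycomb walk (below). [cite: GlazmanManolescu2019, Lemma 2.1 (statement, "in the form given in [Gl]")]
[cite: Glazman2015WeightedSAW, Lemma 3.1 (proof, pp. 6–7)] [cite: DuminilCopinSmirnov2012, proof of Lemma 1 (the winding of the loop)] -/
theorem chordSign_eq_cornerTurn {z₀ z₁ z₂ : Side} (h01 : z₀ ≠ z₁) (h02 : z₀ ≠ z₂) (h12 : z₁ ≠ z₂)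
    (hk : arcKind z₀ z₁ = .corner) :
    chordSign z₀ z₁ z₂ = if z₀ = .W ∨ z₀ = .E then 1 else -1 := by
  revert h01 h02 h12 hk
  cases z₀ <;> cases z₁ <;> cases z₂ <;> decide

namespace ΩG

open YBWalk HV

open private fc_fh fc_ne fh_add_Mv
  from Literature.Probability.RandomPlanarGeometry.YangBaxterSAWGeneralDomain

variable {D : Set Face} {f : Face} {ω : ΩG D origin f} {hr : RootedFace D origin f}

/-- ★★ **THE PUSHED HONEYCOMB WALK OF A `θ`-CORNER RETURNING WALK, WITH ITS ENTRANCE TURN.** Root at the origin, `ω` of class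
`B2a` at `f` with a `θ`-corner arc `z₀ → z₁` (one triangle `T = f.hv z₀`): the honeycomb walk pushed across the short diagonal,
`hvWalk ++ [T]`, is a loop walk at `T` (the winding file's edition 6, `exists_hvWalk_append_eq_lw_of_corner`), the walk first
reaches `T` across `z₀` (from `f.hvAcross z₀`) and the loop starts across `z₁` (towards `f.hvAcross z₁`): the entrance turn is the
turn of the corner arc, `+1` for `z₀ ∈ {W, E}`, `−1` for `z₀ ∈ {S, N}`. [cite: GlazmanManolescu2019, §1 (Fig. 2), Lemma 2.1]
[cite: Glazman2015WeightedSAW, Lemma 3.1 (proof, pp. 6–7)] [cite: DuminilCopinSmirnov2012, proof of Lemma 1 (the walks passing all three mid-edges of a vertex)] -/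
theorem exists_hvWalk_append_eq_lw_entrance (hD : ((-1 : ℤ), (0 : ℤ)) ∉ D) (hr : RootedFace D origin f) (h : ω.IsB2a)
    (hc : arcKind ω.2.firstSideG (ω.z1 hr h) = .corner) :
    ∃ (l₁ l₂ : List HV) (hl₂ : l₂ ≠ []), f.hv ω.2.firstSideG ∉ l₁ ∧
      ω.2.hvWalk ++ [f.hv ω.2.firstSideG] = HV.lw l₁ (f.hv ω.2.firstSideG) l₂ ∧
      HV.turn (HV.lwS l₁) (f.hv ω.2.firstSideG) (l₂.head hl₂) =
        (if ω.2.firstSideG = .W ∨ ω.2.firstSideG = .E then 1 else -1) := by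
  have hfh : ω.2.firstHitG < ω.2.arcs.length := ω.fh_lt h
  have hM : 3 ≤ ω.Mv := three_le_Mv hr h
  have hFM : ω.2.firstHitG + ω.Mv = ω.2.arcs.length := fh_add_Mv h
  obtain ⟨hfc, hsIn, hsOut⟩ := fc_fh ω hr h
  have hz1 : ω.2.sOut ω.2.firstHitG = ω.z1 hr h := hsOut
  have hn : 0 < ω.2.arcs.length := by omega
  have hst : ω.2.firstSideG ≠ ω.z1 hr h := by
    rw [← hsIn, ← hz1]; exact (YBWalk.side_sIn hfh).2.2
  have htri : ω.2.firstSideG.tri = (ω.z1 hr h).tri := (arcKind_eq_corner_iff hst).1 hc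
  obtain ⟨L, hL, hhead⟩ := exists_hvUpTo_add ω.2 (ω.2.firstHitG + 1) (ω.2.arcs.length - (ω.2.firstHitG + 1))
  rw [show ω.2.firstHitG + 1 + (ω.2.arcs.length - (ω.2.firstHitG + 1)) = ω.2.arcs.length by omega] at hL
  have hLhead : L.head? = some (f.hvAcross (ω.z1 hr h)) := by
    rw [hhead (by omega), ← YBWalk.acrossOut_eq_hv_succ (by omega), YBWalk.acrossOut, hfc, hz1]
  have hL0 : L ≠ [] := by intro e; rw [e] at hLhead; simp at hLhead
  have hLhd : L.head hL0 = f.hvAcross (ω.z1 hr h) := by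
    apply Option.some_injective; rw [← List.head?_eq_some_head, hLhead]
  have hch : ω.2.fc (ω.2.arcs.length - 1) ≠ f := fc_ne ω hr h (by omega) (by omega)
  have hv : ω.2.acrossOut (ω.2.arcs.length - 1) = f.hv ω.1 := acrossOut_last_eq_hv rfl hn hch
  have harc : ω.2.arcHV ω.2.firstHitG = [f.hv ω.2.firstSideG] := by
    unfold YBWalk.arcHV
    rw [hfc, hsIn, hz1, if_pos htri]
  have hwalk : ω.2.hvWalk = HV.wOut :: (ω.2.hvUpTo ω.2.firstHitG ++ [f.hv ω.2.firstSideG] ++ L ++ [f.hv ω.1]) := by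
    rw [ω.2.hvWalk_of_origin hD hn, YBWalk.hvInner, hL, YBWalk.hvUpTo_succ, harc, hv]
  have hnot : ∀ s : Side, f.hv s ∉ ω.2.hvUpTo ω.2.firstHitG := by
    intro s hs
    obtain ⟨k, hk, t, he⟩ := exists_fc_of_mem_hvUpTo hs
    have hkf : ω.2.fc k ≠ f := by
      intro e
      have hk' : k < ω.2.arcs.length := by omega
      have hface := (YBWalk.arcFace_arcAt hk').1
      rw [YBWalk.arcAt_eq hk', e, ← ω.2.nth_eq_getElem, ← ω.2.nth_eq_getElem] at hface
      exact ω.2.arcFace_ne_of_lt_firstHitG hk hk' hface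
    exact hkf (Face.hv_eq_hv_iff.1 he.symm).1
  have hprev := getLast_wOut_cons_hvUpTo_firstHitG (ω := ω) hD hr h
  refine ⟨ω.2.hvUpTo ω.2.firstHitG, L ++ [f.hv ω.1], by simp, hnot _, ?_, ?_⟩
  · rw [hwalk, HV.lw]
    simp
  · rw [List.head_append_of_ne_nil hL0, hLhd, HV.lwS, hprev]
    exact turn_hvAcross_hv_hvAcross f hst htri

/-- ★★★ **THE SIGNED DICTIONARY FOR `θ`-CORNER RETURNING WALKS.** Same setting, the arc in `f` now a `θ`-corner (triangle
`T = f.hv z₀`), non-zero `π/3`-weight: the swept angle of the excursion polygon at the midpoint of the root equals `2π` times the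
winding number about the root face of the loop of the PUSHED honeycomb walk `hvWalk ++ [T]` (the diagonal-ending encircling term
of the dictionary; mod 2: the winding file's `loopWnd_hvWalk_append_eq_rayCountAt_mod_two` / `hvWalk_append_mem_clsLoop_of_corner`).
With §5, EVERY returning walk of non-zero weight — corner arc or not — has its Duminil-Copin–Smirnov loop winding number equal to
Glazman–Manolescu's excursion winding. [cite: DuminilCopinSmirnov2012, proof of Lemma 1 (the winding of the loop about a)]
[cite: GlazmanManolescu2019, Lemma 2.1 (statement, "in the form given in [Gl]")] [cite: Glazman2015WeightedSAW, Lemma 3.1 (proof, pp. 6–7)]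
[cite: CourantRobbins1958, Ch. V Appendix §2 (the even–odd rule)] -/
theorem AJ_root_eq_two_pi_mul_loopWnd_of_corner {Dl : List Face} {f : Face} {ω : ΩG (PlaquetteWalk.dom Dl) origin f}
    {hr : RootedFace (PlaquetteWalk.dom Dl) origin f} (hD : ((-1 : ℤ), (0 : ℤ)) ∉ Dl) (h : ω.IsB2a)
    (hc : arcKind ω.2.firstSideG (ω.z1 hr h) = .corner) (hw : ω.2.weight (fun _ => π / 3) ≠ 0) :
    ω.AJ hr h (toC (midPt origin)) =
      2 * π * HV.loopWnd (f.hv ω.2.firstSideG) (ω.2.hvWalk ++ [f.hv ω.2.firstSideG]) := by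
  have hD' : ((-1 : ℤ), (0 : ℤ)) ∉ PlaquetteWalk.dom Dl := hD
  have hDF : ((-1 : ℤ), (0 : ℤ)) ∉ Dl.toFinset := fun e => hD (List.mem_toFinset.1 e)
  obtain ⟨hP, -, hiff⟩ := hvWalk_append_mem_clsLoop_of_corner (hr := hr) hD h hc hw
  by_cases h0 : HV.loopWnd (f.hv ω.2.firstSideG) (ω.2.hvWalk ++ [f.hv ω.2.firstSideG]) = 0
  · have hA : ω.AJ hr h (toC (midPt origin)) = 0 := by
      by_contra hA; exact (hiff.2 hA) h0
    rw [h0, hA]; simp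
  · have hA : ω.AJ hr h (toC (midPt origin)) ≠ 0 := hiff.1 h0
    obtain ⟨l₁, l₂, hl₂, hv, he, hturn⟩ := exists_hvWalk_append_eq_lw_entrance (ω := ω) hD' hr h hc
    rw [he] at hP
    rw [he, HV.loopWnd_lw hv] at h0 ⊢
    have hd := ω.2.sides_distinctG hr h.1
    rw [ω.returnSide_of_isB2a h] at hd
    rw [HV.wnd_loop_eq_turn_of_ne_zero (wOut_not_mem_triSet hDF) hP hl₂ h0, hturn]
    have h01 : ω.2.firstSideG ≠ ω.z1 hr h := fun e => hd.1 e.symm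
    have h02 : ω.2.firstSideG ≠ ω.1 := fun e => hd.2.1 e.symm
    have h12 : ω.z1 hr h ≠ ω.1 := fun e => hd.2.2 e.symm
    rw [(AJ_root_eq_zero_or_eq_chordSign (hr := hr) h).resolve_left hA, chordSign_eq_cornerTurn h01 h02 h12 hc]

/-- ★★ **The sign of the diagonal-ending encircling loop is the chord sign**: wound ⇒ `loopWnd (T) (hvWalk ++ [T]) = chordSign(z₀; z₁, z₂)`
(`+1` for `z₀ ∈ {W, E}`, `−1` for `z₀ ∈ {S, N}`). [cite: DuminilCopinSmirnov2012, proof of Lemma 1 (the winding of the loop)]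
[cite: GlazmanManolescu2019, Lemma 2.1] [cite: Glazman2015WeightedSAW, Lemma 3.1 (proof, pp. 6–7)] -/
theorem loopWnd_hvWalk_append_eq_chordSign_of_wound {Dl : List Face} {f : Face} {ω : ΩG (PlaquetteWalk.dom Dl) origin f}
    {hr : RootedFace (PlaquetteWalk.dom Dl) origin f} (hD : ((-1 : ℤ), (0 : ℤ)) ∉ Dl) (h : ω.IsB2a)
    (hc : arcKind ω.2.firstSideG (ω.z1 hr h) = .corner) (hw : ω.2.weight (fun _ => π / 3) ≠ 0)
    (hA : ω.AJ hr h (toC (midPt origin)) ≠ 0) :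
    HV.loopWnd (f.hv ω.2.firstSideG) (ω.2.hvWalk ++ [f.hv ω.2.firstSideG]) = chordSign ω.2.firstSideG (ω.z1 hr h) ω.1 := by
  have e1 := AJ_root_eq_chordSign_of_ne_zero (hr := hr) h hA
  have e2 := AJ_root_eq_two_pi_mul_loopWnd_of_corner (hr := hr) hD h hc hw
  have hπ : (2 : ℝ) * π ≠ 0 := by positivity
  have key : (2 * π) * ((HV.loopWnd (f.hv ω.2.firstSideG) (ω.2.hvWalk ++ [f.hv ω.2.firstSideG]) : ℤ) : ℝ) =
      (2 * π) * ((chordSign ω.2.firstSideG (ω.z1 hr h) ω.1 : ℤ) : ℝ) := by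
    rw [← e2]; exact e1
  exact_mod_cast mul_left_cancel₀ hπ key

end ΩG

end Corner


/-! ## §7. The excursion-winding defect is twice the root winding angle (edition 2): the reversal lemma of
`YangBaxterSAWExcursionReversal` closes the orientation case of the hole-root bookkeeping — every domain, every root, every θ -/

section DefectSeven

open MidEdge
open Literature.Barriers.CriticalPhenomena.PlaquetteWalk
open Literature.Barriers.CriticalPhenomena (PlaquetteWalk.dom)
open Literature.Topology.PlaneTopology

namespace ΩG

variable {D : Set Face} {a : MidEdge} {r : Face} {ω : ΩG D a r}

/-- ★★★ **THE EXCURSION-WINDING DEFECT IS TWICE THE ROOT WINDING ANGLE.** For every class-`B2a` walk `ω` at a rooted rhombus of ANY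
domain and every angle `θ`: `WE(ω) − excursionWinding(θ; z₀, z₁, z₂) = 2 · AJ(ω; midPt a)` — Glazman–Manolescu's defect of the
excursion winding against its canonical value IS twice the swept angle of the excursion polygon about the midpoint of the root. (The
tree's `WE_sub_excursionWinding_eq_two_mul` had `2A` with `A ∈ {AJ(ω), −AJ(rev ω)}` by orientation; the reversal lemma
`ΩG.AJ_rev_root_eq_neg` identifies the two.) [cite: GlazmanManolescu2019, Lemma 2.1 (statement, «in the form given in [Gl]»)]
[cite: Glazman2015WeightedSAW, Lemma 3.1 (proof, pp. 6–7)] -/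
theorem WE_sub_excursionWinding_eq_two_mul_AJ_root (hr : RootedFace D a r) (h : ω.IsB2a) (θ : ℝ) :
    ω.WE (fun _ => θ) - excursionWinding θ ω.2.firstSideG (ω.z1 hr h) ω.1 = 2 * ω.AJ hr h (toC (midPt a)) := by
  obtain ⟨A, hor, hWE, -⟩ := ω.WE_sub_excursionWinding_eq_two_mul hr h θ
  rw [hWE]
  rcases hor with e | e
  · rw [e]
  · rw [e, AJ_rev_root_eq_neg hr h, neg_neg]

/-- ★★ **WOUND ⟺ THE EXCURSION WINDS ABOUT THE ROOT**: `WE(ω) ≠ excursionWinding(θ; z₀, z₁, z₂) ↔ AJ(ω; midPt a) ≠ 0` — for every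
`θ`, every domain, every rooted rhombus. [cite: GlazmanManolescu2019, Lemma 2.1] [cite: Glazman2015WeightedSAW, Lemma 3.1 (proof, pp. 6–7)] -/
theorem WE_ne_excursionWinding_iff_AJ_root_ne_zero (hr : RootedFace D a r) (h : ω.IsB2a) (θ : ℝ) :
    ω.WE (fun _ => θ) ≠ excursionWinding θ ω.2.firstSideG (ω.z1 hr h) ω.1 ↔ ω.AJ hr h (toC (midPt a)) ≠ 0 := by
  rw [Ne, ← sub_eq_zero, WE_sub_excursionWinding_eq_two_mul_AJ_root hr h θ, mul_eq_zero, not_or]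
  exact ⟨fun h2 => h2.2, fun hA => ⟨two_ne_zero, hA⟩⟩

/-- **Woundness does not depend on the angle**: `WE ≠ excursionWinding` at `θ` iff at `θ'`.
[cite: GlazmanManolescu2019, Lemma 2.1] [cite: Glazman2015WeightedSAW, Lemma 3.1 (proof)] -/
theorem WE_ne_excursionWinding_iff (hr : RootedFace D a r) (h : ω.IsB2a) (θ θ' : ℝ) :
    ω.WE (fun _ => θ) ≠ excursionWinding θ ω.2.firstSideG (ω.z1 hr h) ω.1 ↔
      ω.WE (fun _ => θ') ≠ excursionWinding θ' ω.2.firstSideG (ω.z1 hr h) ω.1 := by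
  rw [WE_ne_excursionWinding_iff_AJ_root_ne_zero hr h θ, WE_ne_excursionWinding_iff_AJ_root_ne_zero hr h θ']

/-- ★★ **A WOUND WALK WINDS `±2π` ABOUT THE ROOT WITH THE SIGN OF ITS CHORD**: if `WE ≠ excursionWinding` then
`AJ(ω; midPt a) = 2π · chordSign(z₀; z₁, z₂)` (Part T's sign rule `ΩG.AJ_root_eq_zero_or_eq_chordSign` with the zero excluded).
[cite: GlazmanManolescu2019, Lemma 2.1 (statement, «in the form given in [Gl]»)] [cite: Glazman2015WeightedSAW, Lemma 3.1 (proof, pp. 6–7)] -/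
theorem AJ_root_eq_chordSign_of_WE_ne (hr : RootedFace D a r) (h : ω.IsB2a) {θ : ℝ}
    (hW : ω.WE (fun _ => θ) ≠ excursionWinding θ ω.2.firstSideG (ω.z1 hr h) ω.1) :
    ω.AJ hr h (toC (midPt a)) = 2 * Real.pi * chordSign ω.2.firstSideG (ω.z1 hr h) ω.1 :=
  AJ_root_eq_chordSign_of_ne_zero (hr := hr) h ((WE_ne_excursionWinding_iff_AJ_root_ne_zero hr h θ).1 hW)

/-- **The wound defect, exactly**: `WE − excursionWinding = 4π · chordSign(z₀; z₁, z₂)` for a wound walk (the tree's `sign_law`, second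
branch, now from the exact defect formula). [cite: GlazmanManolescu2019, Lemma 2.1] [cite: Glazman2015WeightedSAW, Lemma 3.1 (proof)] -/
theorem WE_sub_excursionWinding_eq_of_WE_ne (hr : RootedFace D a r) (h : ω.IsB2a) {θ : ℝ}
    (hW : ω.WE (fun _ => θ) ≠ excursionWinding θ ω.2.firstSideG (ω.z1 hr h) ω.1) :
    ω.WE (fun _ => θ) - excursionWinding θ ω.2.firstSideG (ω.z1 hr h) ω.1 =
      4 * Real.pi * chordSign ω.2.firstSideG (ω.z1 hr h) ω.1 := by
  rw [WE_sub_excursionWinding_eq_two_mul_AJ_root hr h θ, AJ_root_eq_chordSign_of_WE_ne hr h hW]; ring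

/-- ★ **The companion of a wound walk winds the other way, with ITS chord sign**: `AJ(rev ω; midPt a) = 2π · chordSign(z₀; z₂, z₁)
= −2π · chordSign(z₀; z₁, z₂)`. [cite: Glazman2015WeightedSAW, Lemma 3.1 (proof, pp. 6–7: the companion traverses the excursion backwards)]
[cite: GlazmanManolescu2019, Lemma 2.1] -/
theorem AJ_rev_root_eq_chordSign_of_WE_ne (hr : RootedFace D a r) (h : ω.IsB2a) {θ : ℝ}
    (hW : ω.WE (fun _ => θ) ≠ excursionWinding θ ω.2.firstSideG (ω.z1 hr h) ω.1) :
    (ω.rev hr).AJ hr (ω.rev_isB2a hr h) (toC (midPt a)) = 2 * Real.pi * chordSign ω.2.firstSideG ω.1 (ω.z1 hr h) := by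
  obtain ⟨hz01, hz02, hz12⟩ := ω.firstSide_exit_return_distinct hr h
  rw [AJ_rev_root_eq_neg hr h, AJ_root_eq_chordSign_of_WE_ne hr h hW, chordSign_swap _ _ _ hz01 hz02 hz12]
  push_cast; ring

end ΩG

end DefectSeven

/-! ## §8. Every wound walk's loop winds by its chord sign; the loop does not wind iff the walk is unwound (edition 2, θ = π/3) -/

section LoopEight

open MidEdge
open Literature.Barriers.CriticalPhenomena.PlaquetteWalk
open Literature.Barriers.CriticalPhenomena (PlaquetteWalk.dom)
open Literature.Topology.PlaneTopology

namespace ΩG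

variable {Dl : List Face} {f : Face} {ω : ΩG (PlaquetteWalk.dom Dl) origin f}
  {hr : RootedFace (PlaquetteWalk.dom Dl) origin f}

/-- ★★ **EVERY WOUND WALK'S LOOP WINDS BY ITS CHORD SIGN** (non-`θ`-corner arc; the π/3 dictionary). Root at the origin (`(−1,0) ∉ Dl`),
`ω` of class `B2a` at `f` with non-zero `π/3`-weight and a non-`θ`-corner first arc; if `ω` is WOUND in Glazman–Manolescu's sense
(`WE ≠ excursionWinding`, at any angle) then Duminil-Copin–Smirnov's winding number of the loop of its honeycomb walk about the root face
is the chord sign `chordSign(z₀; z₁, z₂) = ±1` (§5 with the winding hypothesis discharged by §7).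
[cite: DuminilCopinSmirnov2012, proof of Lemma 1 (the winding of the loop about a)] [cite: GlazmanManolescu2019, Lemma 2.1] -/
theorem loopWnd_hvWalk_eq_chordSign_of_WE_ne (hD : ((-1 : ℤ), (0 : ℤ)) ∉ Dl) (h : ω.IsB2a)
    (hκ : arcKind ω.2.firstSideG (ω.z1 hr h) ≠ .corner) (hw : ω.2.weight (fun _ => π / 3) ≠ 0) {θ : ℝ}
    (hW : ω.WE (fun _ => θ) ≠ excursionWinding θ ω.2.firstSideG (ω.z1 hr h) ω.1) :
    HV.loopWnd (f.hv ω.1) ω.2.hvWalk = chordSign ω.2.firstSideG (ω.z1 hr h) ω.1 :=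
  loopWnd_hvWalk_eq_chordSign_of_wound hD h hκ hw ((WE_ne_excursionWinding_iff_AJ_root_ne_zero hr h θ).1 hW)

/-- ★ **The same for a `θ`-corner first arc** (the pushed honeycomb walk, §6). [cite: DuminilCopinSmirnov2012, proof of Lemma 1]
[cite: GlazmanManolescu2019, Lemma 2.1] -/
theorem loopWnd_hvWalk_append_eq_chordSign_of_WE_ne (hD : ((-1 : ℤ), (0 : ℤ)) ∉ Dl) (h : ω.IsB2a)
    (hc : arcKind ω.2.firstSideG (ω.z1 hr h) = .corner) (hw : ω.2.weight (fun _ => π / 3) ≠ 0) {θ : ℝ}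
    (hW : ω.WE (fun _ => θ) ≠ excursionWinding θ ω.2.firstSideG (ω.z1 hr h) ω.1) :
    HV.loopWnd (f.hv ω.2.firstSideG) (ω.2.hvWalk ++ [f.hv ω.2.firstSideG]) = chordSign ω.2.firstSideG (ω.z1 hr h) ω.1 :=
  loopWnd_hvWalk_append_eq_chordSign_of_wound hD h hc hw ((WE_ne_excursionWinding_iff_AJ_root_ne_zero hr h θ).1 hW)

/-- ★★ **DUMINIL-COPIN–SMIRNOV'S LOOP DOES NOT WIND ⟺ GLAZMAN–MANOLESCU'S WALK IS UNWOUND** (non-`θ`-corner arc): for `ω` as in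
`loopWnd_hvWalk_eq_chordSign_of_WE_ne`, `loopWnd (f.hv ω.1) (hvWalk ω) = 0 ↔ ω.Unwound hr` (`ΩG.unwound_iff_AJ_root_eq_zero` + §5).
[cite: DuminilCopinSmirnov2012, proof of Lemma 1] [cite: GlazmanManolescu2019, Lemma 2.1 (statement, «in the form given in [Gl]»)] -/
theorem loopWnd_hvWalk_eq_zero_iff_unwound (hD : ((-1 : ℤ), (0 : ℤ)) ∉ Dl) (h : ω.IsB2a)
    (hκ : arcKind ω.2.firstSideG (ω.z1 hr h) ≠ .corner) (hw : ω.2.weight (fun _ => π / 3) ≠ 0) :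
    HV.loopWnd (f.hv ω.1) ω.2.hvWalk = 0 ↔ ω.Unwound hr := by
  rw [unwound_iff_AJ_root_eq_zero hr]
  have e := AJ_root_eq_two_pi_mul_loopWnd (hr := hr) hD h hκ hw
  have hπ : (2 : ℝ) * π ≠ 0 := by positivity
  constructor
  · intro h0 h'
    rw [show ω.AJ hr h' (toC (midPt origin)) = ω.AJ hr h (toC (midPt origin)) from rfl, e, h0]; simp
  · intro hA
    have := hA h
    rw [e, mul_eq_zero] at this
    exact_mod_cast this.resolve_left hπ

/-- ★ **The same for a `θ`-corner first arc** (pushed walk). [cite: DuminilCopinSmirnov2012, proof of Lemma 1] [cite: GlazmanManolescu2019, Lemma 2.1] -/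
theorem loopWnd_hvWalk_append_eq_zero_iff_unwound (hD : ((-1 : ℤ), (0 : ℤ)) ∉ Dl) (h : ω.IsB2a)
    (hc : arcKind ω.2.firstSideG (ω.z1 hr h) = .corner) (hw : ω.2.weight (fun _ => π / 3) ≠ 0) :
    HV.loopWnd (f.hv ω.2.firstSideG) (ω.2.hvWalk ++ [f.hv ω.2.firstSideG]) = 0 ↔ ω.Unwound hr := by
  rw [unwound_iff_AJ_root_eq_zero hr]
  have e := AJ_root_eq_two_pi_mul_loopWnd_of_corner (hr := hr) hD h hc hw
  have hπ : (2 : ℝ) * π ≠ 0 := by positivity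
  constructor
  · intro h0 h'
    rw [show ω.AJ hr h' (toC (midPt origin)) = ω.AJ hr h (toC (midPt origin)) from rfl, e, h0]; simp
  · intro hA
    have := hA h
    rw [e, mul_eq_zero] at this
    exact_mod_cast this.resolve_left hπ

end ΩG

end LoopEight



/-! ## §9. The counting form in Glazman–Manolescu's vocabulary (edition 3): C(f) = the number of WE-wound returning walks of
non-zero weight; the honeycomb loop winds iff the walk is wound -/

section CountingNine

open MidEdge HV
open Literature.Barriers.CriticalPhenomena.PlaquetteWalk
open Literature.Barriers.CriticalPhenomena (PlaquetteWalk.dom)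

namespace ΩG

variable {Dl : List Face}

open scoped Classical in
/-- ★★ **THE COUNTING FORM IN GLAZMAN–MANOLESCU'S OWN VOCABULARY.** Root at the origin (`(−1, 0) ∉ Dl`), any rhombus `f`, any angle
`θ`: the number of Duminil-Copin–Smirnov's ENCIRCLING loop-class walks at the two triangles of `f` (the venture lane's `C(f)`) equals the
number of returning Yang–Baxter walks at `f` of non-zero `π/3`-weight that are WOUND in the sense of Lemma 2.1 — `WE(ω) ≠
excursionWinding(θ; z₀, z₁, z₂)` (the wound-sum file's §5 count had `AJ(root) ≠ 0`; §7 makes the two predicates one, for every `θ`).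
[cite: DuminilCopinSmirnov2012, proof of Lemma 1 (the pairs; the winding of the loop about a)] [cite: GlazmanManolescu2019, Lemma 2.1
(statement, «in the form given in [Gl]»)] [cite: Glazman2015WeightedSAW, Lemma 3.1 (proof, pp. 6–7)] -/
theorem card_encircling_add_card_encircling_eq_card_WE_ne (hD : ((-1 : ℤ), (0 : ℤ)) ∉ Dl) (f : Face) (θ : ℝ) :
    ((clsLoop (triSet Dl.toFinset) (f.hv .W)).filter (fun P => HV.loopWnd (f.hv .W) P ≠ 0)).card +
      ((clsLoop (triSet Dl.toFinset) (f.hv .E)).filter (fun P => HV.loopWnd (f.hv .E) P ≠ 0)).card =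
      ((Finset.univ : Finset (ΩG (PlaquetteWalk.dom Dl) origin f)).filter (fun ω =>
        ω.2.weight (fun _ => π / 3) ≠ 0 ∧
        ∃ (hr : RootedFace (PlaquetteWalk.dom Dl) origin f) (h : ω.IsB2a),
          ω.WE (fun _ => θ) ≠ excursionWinding θ ω.2.firstSideG (ω.z1 hr h) ω.1)).card := by
  rw [card_encircling_add_card_encircling_eq_card_wound hD f]
  congr 1
  refine Finset.filter_congr fun ω _ => ?_
  refine and_congr_right fun _ => ?_
  constructor
  · rintro ⟨hr, h, hA⟩
    exact ⟨hr, h, (WE_ne_excursionWinding_iff_AJ_root_ne_zero hr h θ).2 hA⟩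
  · rintro ⟨hr, h, hW⟩
    exact ⟨hr, h, (WE_ne_excursionWinding_iff_AJ_root_ne_zero hr h θ).1 hW⟩

open scoped Classical in
/-- ★ **No encircling loop at `f` ⟺ every `WE`-wound returning walk at `f` has `π/3`-weight zero** (woundness checked at any `θ`).
[cite: DuminilCopinSmirnov2012, proof of Lemma 1] [cite: GlazmanManolescu2019, Lemma 2.1] -/
theorem encircling_eq_empty_iff_forall_WE_ne_weight_eq_zero (hD : ((-1 : ℤ), (0 : ℤ)) ∉ Dl) (f : Face) (θ : ℝ) :
    ((clsLoop (triSet Dl.toFinset) (f.hv .W)).filter (fun P => HV.loopWnd (f.hv .W) P ≠ 0) = ∅ ∧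
      (clsLoop (triSet Dl.toFinset) (f.hv .E)).filter (fun P => HV.loopWnd (f.hv .E) P ≠ 0) = ∅) ↔
      ∀ (ω : ΩG (PlaquetteWalk.dom Dl) origin f) (hr : RootedFace (PlaquetteWalk.dom Dl) origin f) (h : ω.IsB2a),
        ω.WE (fun _ => θ) ≠ excursionWinding θ ω.2.firstSideG (ω.z1 hr h) ω.1 → ω.2.weight (fun _ => π / 3) = 0 := by
  rw [encircling_eq_empty_iff_forall_wound_weight_eq_zero hD f]
  constructor
  · intro H ω hr h hW
    exact H ω hr h ((WE_ne_excursionWinding_iff_AJ_root_ne_zero hr h θ).1 hW)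
  · intro H ω hr h hA
    exact H ω hr h ((WE_ne_excursionWinding_iff_AJ_root_ne_zero hr h θ).2 hA)

/-- ★ **The honeycomb loop winds ⟺ the walk is wound** (non-`θ`-corner arc, origin root, non-zero `π/3`-weight; woundness checked at
any `θ`): `loopWnd (f.hv ω.1) (hvWalk ω) ≠ 0 ↔ WE(ω) ≠ excursionWinding(θ; z₀, z₁, z₂)`. [cite: DuminilCopinSmirnov2012, proof of Lemma 1]
[cite: GlazmanManolescu2019, Lemma 2.1] -/
theorem loopWnd_hvWalk_ne_zero_iff_WE_ne {f : Face} {ω : ΩG (PlaquetteWalk.dom Dl) origin f}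
    {hr : RootedFace (PlaquetteWalk.dom Dl) origin f} (hD : ((-1 : ℤ), (0 : ℤ)) ∉ Dl) (h : ω.IsB2a)
    (hκ : arcKind ω.2.firstSideG (ω.z1 hr h) ≠ .corner) (hw : ω.2.weight (fun _ => π / 3) ≠ 0) (θ : ℝ) :
    HV.loopWnd (f.hv ω.1) ω.2.hvWalk ≠ 0 ↔ ω.WE (fun _ => θ) ≠ excursionWinding θ ω.2.firstSideG (ω.z1 hr h) ω.1 := by
  rw [WE_ne_excursionWinding_iff_AJ_root_ne_zero hr h θ, AJ_root_eq_two_pi_mul_loopWnd (hr := hr) hD h hκ hw]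
  have hπ : (2 : ℝ) * π ≠ 0 := by positivity
  simp [hπ]

/-- **The same for a `θ`-corner first arc** (pushed honeycomb walk). [cite: DuminilCopinSmirnov2012, proof of Lemma 1] [cite: GlazmanManolescu2019, Lemma 2.1] -/
theorem loopWnd_hvWalk_append_ne_zero_iff_WE_ne {f : Face} {ω : ΩG (PlaquetteWalk.dom Dl) origin f}
    {hr : RootedFace (PlaquetteWalk.dom Dl) origin f} (hD : ((-1 : ℤ), (0 : ℤ)) ∉ Dl) (h : ω.IsB2a)
    (hc : arcKind ω.2.firstSideG (ω.z1 hr h) = .corner) (hw : ω.2.weight (fun _ => π / 3) ≠ 0) (θ : ℝ) :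
    HV.loopWnd (f.hv ω.2.firstSideG) (ω.2.hvWalk ++ [f.hv ω.2.firstSideG]) ≠ 0 ↔
      ω.WE (fun _ => θ) ≠ excursionWinding θ ω.2.firstSideG (ω.z1 hr h) ω.1 := by
  rw [WE_ne_excursionWinding_iff_AJ_root_ne_zero hr h θ, AJ_root_eq_two_pi_mul_loopWnd_of_corner (hr := hr) hD h hc hw]
  have hπ : (2 : ℝ) * π ≠ 0 := by positivity
  simp [hπ]

end ΩG

end CountingNine



/-! ## §10. No wound weight ⇒ the Yang–Baxter relation holds at `f` at `π/3` (edition 4) -/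

section RelationTen

open MidEdge HV
open Literature.Barriers.CriticalPhenomena.PlaquetteWalk
open Literature.Barriers.CriticalPhenomena (PlaquetteWalk.dom)

namespace ΩG

variable {Dl : List Face} {f : Face}

open scoped Classical in
/-- ★★ **NO WOUND WEIGHT ⇒ THE YANG–BAXTER RELATION HOLDS AT `f` AT `θ = π/3`.** Root at the origin (`(−1, 0) ∉ Dl`), `f ∈ Dl`:
if every returning (class-`B2a`) walk at `f` that is WOUND in Glazman–Manolescu's sense (`WE ≠ excursionWinding`, checked at any one
angle `θ`) has `π/3`-weight zero, then the vertex functional of the printed weights vanishes at `f` — the per-walk expansion of the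
defect (the wound-sum file's §3, `vertexFunctional_pi_div_three_origin_eq_sum_wound`) runs over an empty set once §7 identifies
«wound» with «AJ(root) ≠ 0». (The contrapositive is the venture lane's reading of a non-zero `π/3` cell: some wound returning walk at
`f` carries weight.) [cite: GlazmanManolescu2019, Lemma 2.1 and eq. (2.2)] [cite: DuminilCopinSmirnov2012, Lemma 1 and its proof]
[cite: Glazman2015WeightedSAW, Lemma 3.1 (proof, pp. 6–7)] -/
theorem vertexFunctional_pi_div_three_origin_eq_zero_of_forall_WE_ne (hD : ((-1 : ℤ), (0 : ℤ)) ∉ Dl) (hf : f ∈ Dl) (θ : ℝ)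
    (H : ∀ (ω : ΩG (PlaquetteWalk.dom Dl) origin f) (hr : RootedFace (PlaquetteWalk.dom Dl) origin f) (h : ω.IsB2a),
      ω.WE (fun _ => θ) ≠ excursionWinding θ ω.2.firstSideG (ω.z1 hr h) ω.1 → ω.2.weight (fun _ => π / 3) = 0) :
    vertexFunctional (printedWeights (π / 3)) tFiveEighths (ybCoeff (π / 3)) Dl origin f = 0 := by
  have key := vertexFunctional_pi_div_three_origin_eq_sum_wound (f := f) hD hf
  have hA : ∀ (ω : ΩG (PlaquetteWalk.dom Dl) origin f) (hr : RootedFace (PlaquetteWalk.dom Dl) origin f) (h : ω.IsB2a),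
      ω.AJ hr h (toC (midPt origin)) ≠ 0 → ω.2.weight (fun _ => π / 3) = 0 :=
    fun ω hr h hAJ => H ω hr h ((WE_ne_excursionWinding_iff_AJ_root_ne_zero hr h θ).2 hAJ)
  rw [Finset.sum_eq_zero] at key
  · exact (mul_eq_zero.1 key).resolve_left two_mul_omg_sub_one_ne_zero
  intro σ _
  rw [Finset.sum_eq_zero, Finset.sum_eq_zero, add_zero]
  · intro ω hω
    rw [Finset.mem_filter] at hω
    obtain ⟨-, -, hw, hr, h, -, hAJ⟩ := hω
    exact absurd (hA ω hr h hAJ) hw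
  · intro ω hω
    rw [Finset.mem_filter] at hω
    obtain ⟨-, -, hw, hr, h, -, hAJ⟩ := hω
    exact absurd (hA ω hr h hAJ) hw

open scoped Classical in
/-- ★ **No encircling loop at the two triangles of `f` ⇒ the relation holds at `f` at `π/3`** (origin root; the honeycomb-side
statement is the dictionary's `vertexFunctional_printed_pi_div_three_eq_zero_of_loopWnd` for a general `W`-root — here through §9 and
the theorem above, without translation). [cite: DuminilCopinSmirnov2012, Lemma 1] [cite: GlazmanManolescu2019, Lemma 2.1] -/
theorem vertexFunctional_pi_div_three_origin_eq_zero_of_encircling_eq_empty (hD : ((-1 : ℤ), (0 : ℤ)) ∉ Dl) (hf : f ∈ Dl)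
    (hW : (clsLoop (triSet Dl.toFinset) (f.hv .W)).filter (fun P => HV.loopWnd (f.hv .W) P ≠ 0) = ∅)
    (hE : (clsLoop (triSet Dl.toFinset) (f.hv .E)).filter (fun P => HV.loopWnd (f.hv .E) P ≠ 0) = ∅) :
    vertexFunctional (printedWeights (π / 3)) tFiveEighths (ybCoeff (π / 3)) Dl origin f = 0 :=
  vertexFunctional_pi_div_three_origin_eq_zero_of_forall_WE_ne hD hf (π / 3)
    ((encircling_eq_empty_iff_forall_WE_ne_weight_eq_zero hD f (π / 3)).1 ⟨hW, hE⟩)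

end ΩG

end RelationTen


end YangBaxter

end Literature.Probability.RandomPlanarGeometry.SAW
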